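import Mathlib.RingTheory.RootsOfUnity.Basic
import Literature.IUT.HodgeTheaters.GaloisCosetFields
import HarnessLib

/-!
# [EtTh] Def. 3.3 (iii) / Prop. 3.4 (ii) constants for the ARITHMETIC theta tower, part 1 (TYPE):
# constant towers `U ↦ ((Ω^U)^×, v)` over `D⊢_v = CosetCat Gal(Ω/K_v)` with their roots of unity `μ_N(Ω) ∩ Ω^U`

S. Mochizuki, *The étale theta function …*, Publ. RIMS **45** (2009) [MochizukiEtTh2009]: Def. 3.3 (iii) p.299 (PDF p.73)
(«`F₀ ⊆ B₀` for the subfunctor determined by the constant log-meromorphic functions»), Prop. 3.4 (ii) p.300 (PDF p.74)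
(«`O_L^× ≅ Ker(B₀(Y^log) → Φ₀(Y^log)^gp)`; `O_L^▷ ≅ B₀(Y^log) ×_{Φ₀^gp} Φ₀(Y^log)`; `L^× ≅ F₀(Y^log)`» for `Y` geometrically
connected over the finite extension `L` of `K`), §5 p.330 (PDF p.104) / [IUTchI] Ex. 3.2 (ii) p.70 («`O^×_{K_v} → O^×(T^÷_{Ÿ_v})`»,
«a `2l`-th root of unity [i.e., an element of `μ_{2l}(T^÷_{Ÿ_v})`]») [cite: MochizukiEtTh2009, Def 3.3 (iii) p.299 (PDF p.73)];
S. Mochizuki, *The geometry of Frobenioids II* (2008) [MochizukiFrdII2008], Ex. 1.1 (i) p.7 («`Spec(K) ↦ K^×` determines a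
group-like monoid `B₀` on `D₀`», «`ord(O^▷_K) := O^▷_K/O^×_K`»).

abc-iut cell, GAP A (G-L5-EX32I-1, [IUTchI] Ex. 3.2 (i)(ii)(iii)) item GA-01 = row D1 of abc-iut-inv-1's GAP-SIZING-A
(sha16 69de97346848d3e8), seat abc-iut-gapA-01-ConstTower (class L2 typer); chair rulings abc-iut-L5-lead RULINGS #317 (2) /
#319 / #322 (c2′) («constants/valuations genuine at EVERY `U` via `T.proj`/`fieldFunctor`/`fixedFld`/`fixedHom`») and #330 (2)(d)
(SIGNATURE-FIRST: this file is the TYPE; the genuine inhabitant `ConstTower.ofGaloisValDatum` is the sequel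
`ArithThetaTowerConstTowerOfGaloisValDatum.lean`).

WHAT THIS FILE TYPES, for abc-iut-L5-t2's genuine Galois–valuation datum `d : GaloisValDatum p` (`k = K_v` a `p`-adic local field,
`Ω = K̄_v` Galois over `k` with its `Gal(Ω/k)`-invariant valuative relation, `d.Gal = Gal(Ω/k)`; `GaloisCosetFields.lean`):
* `ConstTower d` — a CONSTANT TOWER of `d`: a monoid `units : (CosetCat d.Gal)ᵒᵖ ⥤ CommMonCat` on the small model
  `CosetCat d.Gal` of `D⊢_v = B(K_v)⁰` ([FrdI] convention, the shape of `DivisorMonoids.B₀/F₀`) together with an injective READING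
  `toΩ U : units(U) →* Ωˣ` of every level inside `Ω^×` whose image is EXACTLY `(Ω^U)^×` (the nonzero elements of `Ω` fixed by the
  open subgroup `U`) and along which the restriction map of a covering morphism `G/V → G/U` with point `g·U` is the Galois
  translate `x ↦ g·x` — i.e. a presentation of the genuine constants `U ↦ (Ω^U)^× = K_U^×` with their genuine Galois action;
  every inhabitant is determined up to unique isomorphism by these laws (no hypothesis on the mathematics is carried);
* derived from the reading, for any `K : ConstTower d`: the VALUATION `K.v U : units(U) →* ValueGroupWithZero Ω` (the valuation
  of `Ω` — one value group for all levels), the unit integers `K.intUnits U = O^×(Ω^U) = {v = 1}`, the nonzero integers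
  `K.integers U = O^▷(Ω^U) = {v ≤ 1}`, the RECORDED ROOTS OF UNITY `K.mu N U = μ_N(Ω) ∩ Ω^U = {x | x^N = 1}` with
  `toΩ_mem_rootsOfUnity_iff` (they are the `N`-th roots of unity OF `Ω` lying in `Ω^U`), `mu_le_intUnits` (roots of unity are
  units of `O`), `map_mem_mu_iff` (restriction maps preserve and reflect `μ_N`), `isUnit` (every level is a group),
  `smul_toΩ` (level-`U` constants are `U`-invariant), `map_injective`.
The invariance of `v` under the restriction maps (`Gal(Ω/k)` acts by isometries on ALL of `Ω`) and the genuine inhabitant are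
in the sequel.  HONEST LABEL: pure Galois/valuation bookkeeping over Mathlib and the tree's `GaloisValDatum`; an UNDISPUTED
construction around [IUTchIII] Cor. 3.12 — nothing here bears on Cor. 3.12, no side taken (D-0045), nothing asserts the abc
conjecture; no instance, no notation, no `Prop`-valued definition, no sorry; typed ≠ proved elsewhere ≠ tokened.
-/

namespace Literature.AnabelianGeometry.EtaleTheta

open CategoryTheory Opposite Literature.AnabelianGeometry.SemiGraphs Literature.IUT.HodgeTheaters

universe u

namespace ArithThetaTower

/-- **A constant tower of the Galois–valuation datum `d`** ([EtTh] Def. 3.3 (iii) `F₀`, «`L^× ≅ F₀(Y^log)`» of Prop. 3.4 (ii),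
over `D⊢_v = B(K_v)⁰`): a monoid `U ↦ units(U)` on `CosetCat Gal(Ω/K_v)` read injectively inside `Ω^×` (`toΩ`) with image
exactly the `U`-fixed nonzero elements `(Ω^U)^×`, the restriction map along `G/V → G/U` with point `g·U` being read as
`x ↦ g·x`. [cite: MochizukiEtTh2009, Def 3.3 (iii) p.299 (PDF p.73)] -/
structure ConstTower {p : ℕ} [Fact p.Prime] (d : GaloisValDatum.{u} p) : Type (u + 1) where
  /-- the constants `U ↦ (Ω^U)^×` as a monoid on `CosetCat Gal(Ω/K_v)` (contravariant: pull-back along coverings) -/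
  units : (CosetCat d.Gal)ᵒᵖ ⥤ CommMonCat.{u}
  /-- the reading of the level-`U` constants inside `Ω^×` -/
  toΩ : ∀ U : (CosetCat d.Gal)ᵒᵖ, (units.obj U : Type u) →* d.Ωˣ
  /-- the reading is injective -/
  toΩ_injective : ∀ U : (CosetCat d.Gal)ᵒᵖ, Function.Injective (toΩ U)
  /-- its image is exactly `(Ω^U)^×`: the nonzero elements of `Ω` fixed by `U` -/
  exists_toΩ_eq_iff : ∀ (U : (CosetCat d.Gal)ᵒᵖ) (x : d.Ωˣ),
    (∃ y : units.obj U, toΩ U y = x) ↔ ∀ σ ∈ U.unop.sg, σ (x : d.Ω) = x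
  /-- the restriction map along `G/V → G/U` with point `g·U` reads as the Galois translate `x ↦ g·x` -/
  toΩ_map : ∀ {U V : (CosetCat d.Gal)ᵒᵖ} (f : U ⟶ V) (g : d.Gal),
    CosetCat.pt f.unop = ((g : d.Gal) : U.unop.carrier) →
      ∀ x : units.obj U, ((toΩ V ((units.map f).hom x) : d.Ωˣ) : d.Ω) = g ((toΩ U x : d.Ωˣ) : d.Ω)

namespace ConstTower

variable {p : ℕ} [Fact p.Prime] {d : GaloisValDatum.{u} p} (K : ConstTower d)

/-! ## The reading: invariance, units, injectivity of the restriction maps -/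

/-- Level-`U` constants are `U`-invariant in `Ω`. [cite: MochizukiEtTh2009, Def 3.3 (iii) p.299 (PDF p.73)] -/
theorem smul_toΩ (U : (CosetCat d.Gal)ᵒᵖ) (x : K.units.obj U) {σ : d.Gal} (hσ : σ ∈ U.unop.sg) :
    σ ((K.toΩ U x : d.Ωˣ) : d.Ω) = K.toΩ U x :=
  (K.exists_toΩ_eq_iff U (K.toΩ U x)).mp ⟨x, rfl⟩ σ hσ

/-- The inverse of a level-`U` constant is a level-`U` constant. [cite: MochizukiEtTh2009, Def 3.3 (iii) p.299 (PDF p.73)] -/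
theorem exists_toΩ_eq_inv (U : (CosetCat d.Gal)ᵒᵖ) (x : K.units.obj U) : ∃ y : K.units.obj U, K.toΩ U y = (K.toΩ U x)⁻¹ := by
  refine (K.exists_toΩ_eq_iff U _).mpr fun σ hσ => ?_
  rw [Units.val_inv_eq_inv_val, map_inv₀, K.smul_toΩ U x hσ]

/-- **Every level is a group** (`B₀`/`F₀` are group-like, [FrdII] Ex. 1.1 (i) «a group-like monoid `B₀`»).
[cite: MochizukiFrdII2008, Ex 1.1 (i) p.7] -/
theorem isUnit (U : (CosetCat d.Gal)ᵒᵖ) (x : K.units.obj U) : IsUnit x := by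
  obtain ⟨y, hy⟩ := K.exists_toΩ_eq_inv U x
  refine isUnit_iff_exists_inv.mpr ⟨y, K.toΩ_injective U ?_⟩
  rw [map_mul, hy, mul_inv_cancel, map_one]

/-- The restriction maps read in `Ω`, for ANY representative `g` of the point. [cite: MochizukiEtTh2009, Def 3.3 (iii) p.299 (PDF p.73)] -/
theorem coe_toΩ_map {U V : (CosetCat d.Gal)ᵒᵖ} (f : U ⟶ V) (x : K.units.obj U) {g : d.Gal}
    (hg : CosetCat.pt f.unop = ((g : d.Gal) : U.unop.carrier)) :
    ((K.toΩ V ((K.units.map f).hom x) : d.Ωˣ) : d.Ω) = g ((K.toΩ U x : d.Ωˣ) : d.Ω) :=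
  K.toΩ_map f g hg x

/-- **The restriction maps are injective** (a Galois translate of a nonzero constant determines it).
[cite: MochizukiEtTh2009, Def 3.3 (iii) p.299 (PDF p.73)] -/
theorem map_injective {U V : (CosetCat d.Gal)ᵒᵖ} (f : U ⟶ V) : Function.Injective (K.units.map f).hom := by
  intro x y h
  obtain ⟨g, hg⟩ := Quotient.exists_rep (CosetCat.pt f.unop)
  have h' := congrArg (fun z : K.units.obj V => ((K.toΩ V z : d.Ωˣ) : d.Ω)) h
  simp only [K.coe_toΩ_map f _ hg.symm, EmbeddingLike.apply_eq_iff_eq, Units.val_inj] at h'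
  exact K.toΩ_injective U h'

/-! ## The valuation `v` (one value group, that of `Ω`, for every level) -/

/-- **The valuation of the level-`U` constants**: `v(x) :=` the valuation of `Ω` at the reading of `x` — the pair
`((Ω^U)^×, v)` is the «valued abelian group» of constants at `U`. [cite: MochizukiFrdII2008, Ex 1.1 (i) p.7] -/
noncomputable def v (U : (CosetCat d.Gal)ᵒᵖ) : (K.units.obj U : Type u) →* ValuativeRel.ValueGroupWithZero d.Ω :=
  ((ValuativeRel.valuation d.Ω).toMonoidWithZeroHom.toMonoidHom.comp (Units.coeHom d.Ω)).comp (K.toΩ U)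

/-- `v x` is the valuation of `Ω` at the reading of `x`. [cite: MochizukiFrdII2008, Ex 1.1 (i) p.7] -/
theorem v_apply (U : (CosetCat d.Gal)ᵒᵖ) (x : K.units.obj U) :
    K.v U x = ValuativeRel.valuation d.Ω ((K.toΩ U x : d.Ωˣ) : d.Ω) := rfl

/-- `v x ≠ 0` (constants are nonzero). [cite: MochizukiFrdII2008, Ex 1.1 (i) p.7] -/
theorem v_ne_zero (U : (CosetCat d.Gal)ᵒᵖ) (x : K.units.obj U) : K.v U x ≠ 0 := by
  rw [v_apply]
  exact (Valuation.ne_zero_iff _).mpr (K.toΩ U x).ne_zero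

/-- `v x ≤ 1` iff the reading is `≤ᵥ 1` in `Ω`. [cite: MochizukiFrdII2008, Ex 1.1 (i) p.7] -/
theorem v_le_one_iff (U : (CosetCat d.Gal)ᵒᵖ) (x : K.units.obj U) : K.v U x ≤ 1 ↔ ((K.toΩ U x : d.Ωˣ) : d.Ω) ≤ᵥ 1 := by
  rw [v_apply, Valuation.vle_one_iff (ValuativeRel.valuation d.Ω)]

/-- `v x = 1` iff the reading is `=ᵥ 1` in `Ω`. [cite: MochizukiFrdII2008, Ex 1.1 (i) p.7] -/
theorem v_eq_one_iff (U : (CosetCat d.Gal)ᵒᵖ) (x : K.units.obj U) : K.v U x = 1 ↔ ((K.toΩ U x : d.Ωˣ) : d.Ω) =ᵥ 1 := by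
  rw [v_apply, Valuation.veq_iff_eq (ValuativeRel.valuation d.Ω), map_one]

/-! ## `O^▷(Ω^U)` and `O^×(Ω^U)` inside the constants -/

/-- **`O^▷(Ω^U)`**, the nonzero integers among the level-`U` constants: `{x | v x ≤ 1}` («`O_L^▷ ≅ B₀ ×_{Φ₀^gp} Φ₀`»).
[cite: MochizukiEtTh2009, Prop 3.4 (ii) p.300 (PDF p.74)] -/
def integers (U : (CosetCat d.Gal)ᵒᵖ) : Submonoid (K.units.obj U) where
  carrier := {x | K.v U x ≤ 1}
  one_mem' := by
    change K.v U 1 ≤ 1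
    rw [map_one]
  mul_mem' {x y} hx hy := by
    change K.v U (x * y) ≤ 1
    rw [map_mul]
    exact mul_le_one' hx hy

/-- Membership in `O^▷(Ω^U)`. [cite: MochizukiEtTh2009, Prop 3.4 (ii) p.300 (PDF p.74)] -/
theorem mem_integers_iff (U : (CosetCat d.Gal)ᵒᵖ) (x : K.units.obj U) : x ∈ K.integers U ↔ K.v U x ≤ 1 := Iff.rfl

/-- **`O^×(Ω^U)`**, the unit integers among the level-`U` constants: `{x | v x = 1}` («`O_L^× ≅ Ker(B₀ → Φ₀^gp)`»; the
source of `O^×_{K_v} → O^×(T^÷_{Ÿ_v})` in [IUTchI] Ex. 3.2 (ii)). [cite: MochizukiEtTh2009, Prop 3.4 (ii) p.300 (PDF p.74)] -/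
def intUnits (U : (CosetCat d.Gal)ᵒᵖ) : Submonoid (K.units.obj U) where
  carrier := {x | K.v U x = 1}
  one_mem' := by
    change K.v U 1 = 1
    rw [map_one]
  mul_mem' {x y} hx hy := by
    change K.v U (x * y) = 1
    rw [map_mul, hx, hy, mul_one]

/-- Membership in `O^×(Ω^U)`. [cite: MochizukiEtTh2009, Prop 3.4 (ii) p.300 (PDF p.74)] -/
theorem mem_intUnits_iff (U : (CosetCat d.Gal)ᵒᵖ) (x : K.units.obj U) : x ∈ K.intUnits U ↔ K.v U x = 1 := Iff.rfl

/-- `O^×(Ω^U) ⊆ O^▷(Ω^U)`. [cite: MochizukiEtTh2009, Prop 3.4 (ii) p.300 (PDF p.74)] -/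
theorem intUnits_le_integers (U : (CosetCat d.Gal)ᵒᵖ) : K.intUnits U ≤ K.integers U := fun _ hx => le_of_eq hx

/-- `O^×(Ω^U)` is inverse-closed: the inverse (in the group of constants) of a unit integer is a unit integer.
[cite: MochizukiEtTh2009, Prop 3.4 (ii) p.300 (PDF p.74)] -/
theorem inv_mem_intUnits (U : (CosetCat d.Gal)ᵒᵖ) {x y : K.units.obj U} (hxy : x * y = 1) (hx : x ∈ K.intUnits U) :
    y ∈ K.intUnits U := by
  rw [mem_intUnits_iff] at hx ⊢
  have h := congrArg (K.v U) hxy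
  rwa [map_mul, map_one, hx, one_mul] at h

/-! ## The recorded roots of unity `μ_N(Ω) ∩ Ω^U` -/

/-- **`μ_N` of the level-`U` constants**: `{x | x^N = 1}` — by `toΩ_mem_rootsOfUnity_iff` exactly the `N`-th roots of unity
OF `Ω` that lie in `Ω^U`, `μ_N(Ω) ∩ Ω^U` (print's «`μ_{2l}(T^÷_{Ÿ_v})`» at `N = 2l`). [cite: MochizukiEtTh2009, §5 p.330 (PDF p.104)] -/
def mu (N : ℕ) (U : (CosetCat d.Gal)ᵒᵖ) : Submonoid (K.units.obj U) where
  carrier := {x | x ^ N = 1}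
  one_mem' := one_pow N
  mul_mem' {x y} hx hy := by
    change (x * y) ^ N = 1
    rw [mul_pow, hx, hy, mul_one]

/-- Membership in `μ_N`. [cite: MochizukiEtTh2009, §5 p.330 (PDF p.104)] -/
theorem mem_mu_iff (N : ℕ) (U : (CosetCat d.Gal)ᵒᵖ) (x : K.units.obj U) : x ∈ K.mu N U ↔ x ^ N = 1 := Iff.rfl

/-- **`μ_N(level U) = μ_N(Ω) ∩ Ω^U`**: a level-`U` constant lies in `μ_N` iff its reading is an `N`-th root of unity of `Ω`
(Mathlib's `rootsOfUnity N Ω`). [cite: MochizukiEtTh2009, §5 p.330 (PDF p.104)] -/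
theorem toΩ_mem_rootsOfUnity_iff (N : ℕ) (U : (CosetCat d.Gal)ᵒᵖ) (x : K.units.obj U) :
    K.toΩ U x ∈ rootsOfUnity N d.Ω ↔ x ∈ K.mu N U := by
  rw [mem_rootsOfUnity, mem_mu_iff, ← map_pow, ← (K.toΩ U).map_one]
  exact (K.toΩ_injective U).eq_iff

/-- Conversely every `N`-th root of unity of `Ω` fixed by `U` IS (the reading of) an element of `μ_N(level U)`.
[cite: MochizukiEtTh2009, §5 p.330 (PDF p.104)] -/
theorem exists_mem_mu_toΩ_eq (N : ℕ) (U : (CosetCat d.Gal)ᵒᵖ) {ζ : d.Ωˣ} (hζ : ζ ∈ rootsOfUnity N d.Ω)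
    (hfix : ∀ σ ∈ U.unop.sg, σ (ζ : d.Ω) = ζ) : ∃ x ∈ K.mu N U, K.toΩ U x = ζ := by
  obtain ⟨x, hx⟩ := (K.exists_toΩ_eq_iff U ζ).mpr hfix
  refine ⟨x, ?_, hx⟩
  rw [← toΩ_mem_rootsOfUnity_iff, hx]
  exact hζ

/-- **Roots of unity are unit integers**: `μ_N ⊆ O^×(Ω^U)` for `N ≠ 0` (a valuation takes the value `1` on torsion).
[cite: MochizukiEtTh2009, §5 p.330 (PDF p.104)] -/
theorem mu_le_intUnits {N : ℕ} (hN : N ≠ 0) (U : (CosetCat d.Gal)ᵒᵖ) : K.mu N U ≤ K.intUnits U := by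
  intro x hx
  rw [mem_mu_iff] at hx
  rw [mem_intUnits_iff]
  have hpow : K.v U x ^ N = 1 := by rw [← map_pow, hx, map_one]
  rcases lt_trichotomy (K.v U x) 1 with hlt | heq | hgt
  · exact absurd hpow (pow_lt_one₀ zero_le hlt hN).ne
  · exact heq
  · exact absurd hpow (one_lt_pow₀ hgt hN).ne'

/-- **The restriction maps preserve and reflect `μ_N`** (they are injective monoid homomorphisms).
[cite: MochizukiEtTh2009, §5 p.330 (PDF p.104)] -/
theorem map_mem_mu_iff (N : ℕ) {U V : (CosetCat d.Gal)ᵒᵖ} (f : U ⟶ V) (x : K.units.obj U) :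
    (K.units.map f).hom x ∈ K.mu N V ↔ x ∈ K.mu N U := by
  rw [mem_mu_iff, mem_mu_iff, ← map_pow, ← (K.units.map f).hom.map_one]
  exact (K.map_injective f).eq_iff

/-- The reading of `μ_N(level U)` along a restriction map is the Galois translate, again a root of unity of `Ω`.
[cite: MochizukiEtTh2009, §5 p.330 (PDF p.104)] -/
theorem toΩ_map_mem_rootsOfUnity (N : ℕ) {U V : (CosetCat d.Gal)ᵒᵖ} (f : U ⟶ V) {x : K.units.obj U} (hx : x ∈ K.mu N U) :
    K.toΩ V ((K.units.map f).hom x) ∈ rootsOfUnity N d.Ω :=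
  (K.toΩ_mem_rootsOfUnity_iff N V _).mpr ((K.map_mem_mu_iff N f x).mpr hx)

end ConstTower

end ArithThetaTower

end Literature.AnabelianGeometry.EtaleTheta
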